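import Literature.Probability.Percolation.IntTermFence
import Literature.Probability.Percolation.TrapArmPieces
import HarnessLib

/-!
# Pieces of an arm near an internal extremity (twin of `TrapArmPieces.lean`)

Topic `Literature/Probability/Percolation`; family `crit-perc` / near-critical percolation on `𝕋`.
A brick of the INNER half of the near-critical arm-separation theorem for four arms in the ADJACENT
colour arrangement (P. Nolin, EJP 13 (2008), Thm. 11, `j = 4`, `σ = BBWW` [arXiv 0711.4948:
Thm. 10], §4.4 Lemma 15, internal extremities): the two walk-surgery lemmas of the pair step, on the
inner half-annulus `haFin m` / `intDom m`:

* `int_exists_entry_subwalk` — the piece of an arm inside the half-annulus ending at a vertex `x`,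
  after its last visit outside (`x₀ < 0` or `|x| > 2m`): a self-avoiding walk from a site of the
  start set `(intDom m).F` inside `haFin m`;
* `int_exists_last_contact` — the approach of an open arm to the fence zone of a raw-good term:
  after its last vertex in `lower c z` (a site of `c` in the `7k`-box) it runs off `lower c z`, in
  the half-annulus, in `above c z`, inside the `7k`-box (inner exclusion ring);
* `int_not_mem_of_box7_offLower` — that piece meets no later term (outer exclusion ring);
* `int_exists_final_crossing_walk` — the final half-annulus crossing of a clean arm (twin of
  `exists_final_crossing_walk`).

Everything here is proved; no named facts are introduced.

## References

* P. Nolin, Near-critical percolation in two dimensions, *Electron. J. Probab.* 13 (2008), §4.4,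
  proof of Lemma 15, internal extremities (arXiv 0711.4948: Lemma 14) [Nolin2008].
-/

noncomputable section

open Set

namespace Literature.Probability.Percolation

open LatticeModels HalfAnnulus Literature.Combinatorics.SimpleGraph

/-! ### The piece of an arm inside the half-annulus ending at a vertex -/

/-- **The piece inside the half-annulus ending at `x`.** Let `α : b ⇝ y` be a self-avoiding
`𝕋`-walk with all vertices of norm `≥ m`, starting beyond `Λ_{2m}` (`|b| > 2m`), and let `x` be a
vertex of `α` with `0 ≤ x₀` and `|x| ≤ 2m`. Then the part of `α` up to `x`, after its last visit of
`{v₀ < 0} ∪ {|v| > 2m}`, is a self-avoiding walk `γ : f ⇝ x` from a site `f` of the start set of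
`intDom m` inside `haFin m`, all of whose vertices are vertices of `α.takeUntil x`. [cite: Nolin2008, §4.4, internal extremities (arXiv 0711.4948: proof of Lemma 14)] -/
theorem int_exists_entry_subwalk {m : ℕ} {b y : Site 2} (α : triGraph.Walk b y) (hα : α.IsPath)
    (hsupp : ∀ v ∈ α.support, (m : ℤ) ≤ triNorm v) (hb : 2 * (m : ℤ) < triNorm b) {x : Site 2} (hx : x ∈ α.support)
    (hx0 : 0 ≤ x 0) (hxn : triNorm x ≤ 2 * m) :
    ∃ (f : Site 2) (β : triGraph.Walk b f) (γ : triGraph.Walk f x), α.takeUntil x hx = β.append γ ∧ f ∈ (intDom m).F ∧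
      γ.IsPath ∧ (∀ v ∈ γ.support, v ∈ haFin m) ∧ (∀ v ∈ γ.support, v ∈ (α.takeUntil x hx).support) := by
  classical
  set αx := α.takeUntil x hx with hαx
  have hαxpath : αx.IsPath := hα.takeUntil hx
  have hsub : ∀ v ∈ αx.support, v ∈ α.support := fun v hv => α.support_takeUntil_subset_support hx hv
  -- the last vertex of `αx` in `C = {v₀ < 0} ∪ {|v| > 2m}`
  set C : Set (Site 2) := {v | v 0 < 0 ∨ 2 * (m : ℤ) < triNorm v} with hC
  obtain ⟨p, β₀, γ₀, hαeq, hpC, hplast⟩ := exists_append_last_mem C αx ⟨b, αx.start_mem_support, Or.inr hb⟩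
  have hpC' : p 0 < 0 ∨ 2 * (m : ℤ) < triNorm p := hpC
  have hpx : p ≠ x := fun h => by rw [h] at hpC'; omega
  obtain ⟨f, hpf, γ, hγ₀⟩ := SimpleGraph.Walk.exists_eq_cons_of_ne hpx γ₀
  have hpath₀ : (β₀.append γ₀).IsPath := by rw [← hαeq]; exact hαxpath
  have hγ₀path : γ₀.IsPath := (isPath_append_iff'.1 hpath₀).2.1
  rw [hγ₀] at hγ₀path
  have hγpath : γ.IsPath := ((SimpleGraph.Walk.cons_isPath_iff hpf γ).1 hγ₀path).1
  have hpγ : p ∉ γ.support := ((SimpleGraph.Walk.cons_isPath_iff hpf γ).1 hγ₀path).2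
  have hγsub₀ : ∀ v ∈ γ.support, v ∈ γ₀.support := fun v hv => by rw [hγ₀]; exact List.mem_cons_of_mem _ hv
  have hγsub : ∀ v ∈ γ.support, v ∈ αx.support := fun v hv => by
    rw [hαeq, SimpleGraph.Walk.mem_support_append_iff]; exact Or.inr (hγsub₀ v hv)
  have hγC : ∀ v ∈ γ.support, 0 ≤ v 0 ∧ triNorm v ≤ 2 * m := by
    intro v hv
    by_contra h
    have hvC : v ∈ C := by simp only [hC, Set.mem_setOf_eq]; omega
    exact hpγ ((hplast v (hγsub₀ v hv) hvC) ▸ hv)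
  have hγD : ∀ v ∈ γ.support, v ∈ haFin m := fun v hv =>
    mem_haFin.2 ⟨(hγC v hv).1, hsupp v (hsub v (hγsub v hv)), (hγC v hv).2⟩
  have hfF : f ∈ (intDom m).F := by
    refine mem_intDom_F.2 ⟨hγD f γ.start_mem_support, ?_⟩
    have h1 := hγC f γ.start_mem_support
    have h2 := triGraph_adj_coord hpf 0
    have h3 := triNorm_le_triNorm_add_one_of_adj hpf
    have h4 := triNorm_le_triNorm_add_one_of_adj hpf.symm
    rcases hpC' with h | h
    · left; omega
    · right; omega
  refine ⟨f, β₀.concat hpf, γ, ?_, hfF, hγpath, hγD, hγsub⟩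
  rw [hαeq, hγ₀, SimpleGraph.Walk.concat_eq_append, ← SimpleGraph.Walk.append_assoc, SimpleGraph.Walk.cons_append,
    SimpleGraph.Walk.nil_append]

/-! ### The approach of an open arm to an inner fence zone -/

/-- **The last contact before entering an inner fence zone.** Let `c` (tip `z`) be a crossing of
`intDom m`, raw-good at scale `k ≥ 1` (`4 · 4k < m`), and let `α : b ⇝ y` be a self-avoiding open
`𝕋`-walk with vertices of norm `≥ m` starting outside the `7k`-box about `z`. If a vertex `q` of `α`
lies in the `3k`-box about `z` and off `lower c z`, then after its last vertex `ℓ` in `lower c z`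
— a site of `c` in the `7k`-box — the part of `α` up to `q` is a walk `γ' : s ⇝ q` (`ℓ ~ s`) all of
whose vertices are off `lower c z`, in the half-annulus, in `above c z` and inside the `7k`-box. [cite: Nolin2008, §4.4 Lemma 15 (proof), internal extremities (arXiv 0711.4948: Lemma 14)] -/
theorem int_exists_last_contact {m k : ℕ} {c : Finset (Site 2)} {z : Site 2} {ω : SiteConfig (Site 2)}
    (h : IntRawOK m c z k ω) (hk : 1 ≤ k) (hkm : 4 * (4 * k) < m) (hc : (intDom m).IsCrossing c z)
    {b y : Site 2} (α : triGraph.Walk b y) (hα : α.IsPath) (hsupp : ∀ v ∈ α.support, (m : ℤ) ≤ triNorm v)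
    (hω : ∀ v ∈ α.support, v ∈ ω) (hb : b 0 ≤ z 0 - 7 * k ∨ z 0 + 7 * k ≤ b 0 ∨ b 1 ≤ z 1 - 7 * k ∨ z 1 + 7 * k ≤ b 1)
    {q : Site 2} (hq : q ∈ α.support)
    (hqbox : z 0 - 3 * k ≤ q 0 ∧ q 0 ≤ z 0 + 3 * k ∧ z 1 - 3 * k ≤ q 1 ∧ q 1 ≤ z 1 + 3 * k)
    (hql : q ∉ (intDom m).lower c z) :
    ∃ (ℓ s : Site 2) (β : triGraph.Walk b ℓ) (hℓs : triGraph.Adj ℓ s) (γ' : triGraph.Walk s q),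
      α.takeUntil q hq = β.append (SimpleGraph.Walk.cons hℓs γ') ∧ ℓ ∈ c ∧
      (z 0 - 7 * k - 1 ≤ ℓ 0 ∧ ℓ 0 ≤ z 0 + 7 * k ∧ z 1 - 7 * k - 1 ≤ ℓ 1 ∧ ℓ 1 ≤ z 1 + 7 * k) ∧
      (∀ v ∈ γ'.support, v ∉ (intDom m).lower c z ∧ v ∈ haFin m ∧ v ∈ (intDom m).above c z ∧
        (z 0 - 7 * k < v 0 ∧ v 0 < z 0 + 7 * k ∧ z 1 - 7 * k < v 1 ∧ v 1 < z 1 + 7 * k)) ∧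
      (∀ v ∈ γ'.support, v ∈ (α.takeUntil q hq).support) ∧ ℓ ∈ (α.takeUntil q hq).support := by
  classical
  set αq := α.takeUntil q hq with hαq
  have hαqpath : αq.IsPath := hα.takeUntil hq
  have hsub : ∀ v ∈ αq.support, v ∈ α.support := fun v hv => α.support_takeUntil_subset_support hq hv
  set L : Set (Site 2) := ↑((intDom m).lower c z) with hL
  obtain ⟨hz0, hz1, hz2⟩ := (mem_intDom_J.1 hc.tip_mem_J).2
  have hk' : (1 : ℤ) ≤ k := by exact_mod_cast hk
  have hkm' : 4 * (4 * (k : ℤ)) < m := by exact_mod_cast hkm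
  -- the inner ring, applied along the open walk
  have hring : ∀ {s t : Site 2}, PathIn triGraph (Lᶜ ∩ ω) s t →
      (z 0 - 3 * k ≤ s 0 ∧ s 0 ≤ z 0 + 3 * k ∧ z 1 - 3 * k ≤ s 1 ∧ s 1 ≤ z 1 + 3 * k) →
      ¬ (t 0 ≤ z 0 - 7 * k ∨ z 0 + 7 * k ≤ t 0 ∨ t 1 ≤ z 1 - 7 * k ∨ z 1 + 7 * k ≤ t 1) :=
    fun hp hs ht => h.inner_ring hk hs ht hp
  -- `αq` meets `L`
  have hmeet : ∃ v ∈ αq.support, v ∈ L := by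
    by_contra hno
    push Not at hno
    have hp : PathIn triGraph (Lᶜ ∩ ω) q b :=
      (PathIn.of_walk_mem_support αq (A := Lᶜ ∩ ω) (fun v hv => ⟨hno v hv, hω v (hsub v hv)⟩) αq.end_mem_support).1.symm
    exact hring hp hqbox hb
  obtain ⟨ℓ, β, γ, hαeq, hℓL, hℓlast⟩ := exists_append_last_mem L αq hmeet
  have hγsub : ∀ v ∈ γ.support, v ∈ αq.support := fun v hv => by
    rw [hαeq, SimpleGraph.Walk.mem_support_append_iff]; exact Or.inr hv
  have hℓq : ℓ ≠ q := fun h' => hql (by rw [← h']; exact Finset.mem_coe.1 hℓL)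
  obtain ⟨s, hℓs, γ', hγ'⟩ := SimpleGraph.Walk.exists_eq_cons_of_ne hℓq γ
  have hpath₀ : (β.append γ).IsPath := by rw [← hαeq]; exact hαqpath
  have hγpath : γ.IsPath := (isPath_append_iff'.1 hpath₀).2.1
  rw [hγ'] at hγpath
  have hℓγ' : ℓ ∉ γ'.support := ((SimpleGraph.Walk.cons_isPath_iff hℓs γ').1 hγpath).2
  have hγ'sub : ∀ v ∈ γ'.support, v ∈ γ.support := fun v hv => by rw [hγ']; exact List.mem_cons_of_mem _ hv
  have hoff : ∀ v ∈ γ'.support, v ∉ L := fun v hv hvL => hℓγ' ((hℓlast v (hγ'sub v hv) hvL) ▸ hv)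
  have hγ'A : ∀ v ∈ γ'.support, v ∈ Lᶜ ∩ ω := fun v hv => ⟨hoff v hv, hω v (hsub v (hγsub v (hγ'sub v hv)))⟩
  have hbox : ∀ v ∈ γ'.support, z 0 - 7 * k < v 0 ∧ v 0 < z 0 + 7 * k ∧ z 1 - 7 * k < v 1 ∧ v 1 < z 1 + 7 * k := by
    intro v hv
    have hp : PathIn triGraph (Lᶜ ∩ ω) q v := (PathIn.of_walk_mem_support γ' (A := Lᶜ ∩ ω) hγ'A hv).2.symm
    have := hring hp hqbox
    omega
  have hD : ∀ v ∈ γ'.support, v ∈ haFin m := by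
    intro v hv
    have hb' := hbox v hv
    refine mem_haFin.2 ⟨by omega, hsupp v (hsub v (hγsub v (hγ'sub v hv))), ?_⟩
    rw [triNorm_eq_max]; omega
  have habove : ∀ v ∈ γ'.support, v ∈ (intDom m).above c z := fun v hv => by
    have hvD : v ∈ (intDom m).D := hD v hv
    by_contra hna
    exact hoff v hv (Finset.mem_coe.2 ((JDomain.mem_lower_iff_not_mem_above hvD).2 hna))
  have hsa := habove s γ'.start_mem_support
  have hℓD : ℓ ∈ (intDom m).D := JDomain.lower_subset_D hc.subset (Finset.mem_coe.1 hℓL)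
  have hℓc : ℓ ∈ c := by
    by_contra hℓc
    have hℓa : ℓ ∈ (intDom m).above c z := JDomain.mem_above_of_adj hsa hℓD hℓc hℓs.symm
    exact (JDomain.mem_lower_iff_not_mem_above hℓD).1 (Finset.mem_coe.1 hℓL) hℓa
  have hℓbox : z 0 - 7 * k - 1 ≤ ℓ 0 ∧ ℓ 0 ≤ z 0 + 7 * k ∧ z 1 - 7 * k - 1 ≤ ℓ 1 ∧ ℓ 1 ≤ z 1 + 7 * k := by
    have hs := hbox s γ'.start_mem_support
    have h0 := triGraph_adj_coord hℓs 0
    have h1 := triGraph_adj_coord hℓs 1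
    omega
  refine ⟨ℓ, s, β, hℓs, γ', by rw [hαeq, hγ'], hℓc, hℓbox, fun v hv => ⟨?_, hD v hv, habove v hv, hbox v hv⟩,
    fun v hv => hγsub v (hγ'sub v hv), hγsub ℓ γ.start_mem_support⟩
  exact fun hvl => hoff v hv (Finset.mem_coe.2 hvl)

/-- **The piece before an inner fence zone meets no later term** (`4 · 16k < m`). [cite: Nolin2008, §4.4 Lemma 15 (proof), internal extremities (arXiv 0711.4948: Lemma 14)] -/
theorem int_not_mem_of_box7_offLower {m k : ℕ} {c : Finset (Site 2)} {z : Site 2} {ω : SiteConfig (Site 2)}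
    (h : IntRawOK m c z k ω) (hk : 1 ≤ k) (hkm : 4 * (16 * k) < m) (hc : (intDom m).IsCrossing c z)
    {c' : Finset (Site 2)} {z' : Site 2} (hc' : (intDom m).IsCrossing c' z') (hc'ω : (↑c' : Set (Site 2)) ⊆ ω)
    (hoff : ∀ v ∈ c', v ∉ (intDom m).lower c z) {v : Site 2}
    (hv : z 0 - 7 * k < v 0 ∧ v 0 < z 0 + 7 * k ∧ z 1 - 7 * k < v 1 ∧ v 1 < z 1 + 7 * k) : v ∉ c' := by
  intro hvc'
  obtain ⟨f, hfc', hfF⟩ := hc'.exists_start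
  obtain ⟨hz0, hz1, hz2⟩ := (mem_intDom_J.1 hc.tip_mem_J).2
  have hfar := start_far_from_ends (R := 16 * k) hkm hfF (z 1) ⟨by omega, by omega⟩
  have hA : (↑c' : Set (Site 2)) ⊆ ((↑((intDom m).lower c z) : Set (Site 2))ᶜ ∩ ω) :=
    fun w hw => ⟨fun h' => hoff w (Finset.mem_coe.1 hw) (Finset.mem_coe.1 h'), hc'ω hw⟩
  exact h.not_box17_of_offLower hk hA (hc'.conn v hvc' f hfc') (by push_cast at hfar ⊢; omega) ⟨by omega, by omega, by omega, by omega⟩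

/-! ### The final crossing of a clean arm -/

/-- **The final half-annulus crossing of a clean inner arm.** Let `α : b ⇝ y` be a self-avoiding
`𝕋`-walk with all vertices of norm `≥ m`, `|b| > 2m`, ending at a site `y` of the inner tip arc
(`IsIntJ m y`) and meeting `∂Λ_m` only at `y`. Then `α = β ++ γ` where `γ : f ⇝ y` starts at a
site `f` of the start set of `intDom m`, runs inside `haFin m`, is self-avoiding, and its support is
a crossing of `intDom m` with tip `y`. [cite: Nolin2008, §4.4, internal extremities (arXiv 0711.4948: proof of Lemma 14)] -/
theorem int_exists_final_crossing_walk {m : ℕ} {b y : Site 2} (α : triGraph.Walk b y) (hα : α.IsPath)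
    (hsupp : ∀ v ∈ α.support, (m : ℤ) ≤ triNorm v) (hb : 2 * (m : ℤ) < triNorm b) (hy : IsIntJ m y)
    (hclean : ∀ v ∈ α.support, triNorm v = m → v = y) :
    ∃ (f : Site 2) (β : triGraph.Walk b f) (γ : triGraph.Walk f y), α = β.append γ ∧ f ∈ (intDom m).F ∧ γ.IsPath ∧
      (∀ v ∈ γ.support, v ∈ haFin m) ∧ (∀ v ∈ γ.support, v ∈ α.support) ∧
      (intDom m).IsCrossing γ.support.toFinset y := by
  classical
  obtain ⟨hy0, hy1, hy2⟩ := hy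
  have hyn : triNorm y = m := by rw [triNorm_eq_max]; omega
  have hm1 : (1 : ℤ) ≤ m := by omega
  obtain ⟨f, β, γ, hαeq, hfF, hγpath, hγD, hγsub⟩ :=
    int_exists_entry_subwalk α hα hsupp hb α.end_mem_support (by omega) (by omega)
  have htake : α.takeUntil y α.end_mem_support = α := by
    have h1 := α.take_spec α.end_mem_support
    have h2 : α.dropUntil y α.end_mem_support = SimpleGraph.Walk.nil :=
      (SimpleGraph.Walk.isPath_iff_nil.1 (hα.dropUntil _)).eq_nil
    rwa [h2, SimpleGraph.Walk.append_nil] at h1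
  rw [htake] at hαeq hγsub
  · refine ⟨f, β, γ, hαeq, hfF, hγpath, hγD, hγsub, ?_⟩
    refine
      { subset := fun v hv => hγD v (List.mem_toFinset.1 hv)
        tip_mem := List.mem_toFinset.2 γ.end_mem_support
        tip_mem_J := mem_intDom_J.2 ⟨hγD y γ.end_mem_support, ⟨hy0, hy1, hy2⟩⟩
        eq_tip := fun v hv hvJ => ?_
        exists_start := ⟨f, List.mem_toFinset.2 γ.start_mem_support, hfF⟩
        conn := fun u hu v hv => ?_ }
    · have hvJ' := (mem_intDom_J.1 hvJ).2
      obtain ⟨hv0, hv1, hv2⟩ := hvJ'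
      have hvn : triNorm v = m := by rw [triNorm_eq_max]; omega
      exact hclean v (hγsub v (List.mem_toFinset.1 hv)) hvn
    · have pu := (PathIn.of_walk_mem_support γ (fun w hw => Finset.mem_coe.2 (List.mem_toFinset.2 hw)) (List.mem_toFinset.1 hu)).1
      have pv := (PathIn.of_walk_mem_support γ (fun w hw => Finset.mem_coe.2 (List.mem_toFinset.2 hw)) (List.mem_toFinset.1 hv)).1
      exact pu.symm.trans pv

end Literature.Probability.Percolation
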